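import Summits.BirchSwinnertonDyer.BirchSwinnertonDyer.Theorems.KimAtThreeKolyvaginDeepLowerKatoStratumPartial
import HarnessLib

/-!
# Crux `DeepLowerAtThree` (item 19075) on the Kato stratum at `t = 0`: the Poitou–Tate families of the
# GRANTED-ports rung taken from the NAMED FACT `poitouTate_selmerStructure_duality ℚ` — route W2
# `KimAtThreeKolyvagin`, cell `bsd-addord`, seat w2-c2 (D-0074 row B5)

HONEST FRAMING. Theorems only (no definition, no named fact minted, no `sorry`); nothing asserted,
nothing booked; crux 19075 stays OPEN. This file is the "what the rung costs" form of seat kim3's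
`KimAtThreeKolyvaginDeepLowerKatoStratumPartial.deepLower_datum_of_ports` /
`deepLower_optimal_of_ports` (gen 8): there, the `∂`-currency conclusion of crux `DeepLowerAtThree`
on the stratum {`3`-adic tower onto, ADDITIVE `3` with `3 ∤ c₃`, `E(ℚ₃)[3] = 0`, `ord(δ̃) = 0`, datum
at the conductor with `3 ∤ c_D` + period transfer / optimality} is derived GRANTED cell n1011's (a′)
inputs, among which NINE data binders — a Poitou–Tate family `inv` at `3` and families `inv′ k′` at
every `3^{k′+1}` with local perfectness, the Poitou–Tate vanishing, the Selmer-complement property and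
injectivity of the finite local invariant maps. All nine are instances of ONE named Literature fact,
`Literature.NumberTheory.GaloisCohomology.poitouTate_selmerStructure_duality ℚ` (Milne ADT I 4.10,
Howard 2004 Thm. 2.1.11, Rubin 2000 Thm. 1.7.3, Mazur–Rubin 2004 Thm. 2.3.4 — PUBLISHED; the same
device cell n1011 uses for its record corollaries, `…LevelTwoEndOfFacts`), injectivity being part of
`IsPerfect`. After this file the rung's hypotheses are: three named PUBLISHED facts ([S24] Thm. 4.4
(1)(2) typed `hS24`/`hS24₂`, GZK `hGZK`, Poitou–Tate `hPT`), the row, the place `v₃ ∣ 3` with primitive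
roots `η` (data of the port), and ONE kernel-open debt: the repaired dictionary port
`KatoKuriharaPortThreeAtWith₂ W 0 v₃ η D` (FLAG `K22-Thm3.13-PORT@3`, Kim's refined explicit
reciprocity law at an additive `3` = memo kim3/KIM3-PROOF.md §4 Prop. D; not in print at `3`; shared
with crux 19076).

* `deepLower_datum_of_ports_of_poitouTate` — period-transfer form;
* `deepLower_optimal_of_ports_of_poitouTate` — optimal-datum form.

References: [MilneADT2006] I Cor. 2.3, Thm. 4.10; [Howard2004HeegnerKolyvagin] Thm. 2.1.11;
[Sakamoto2024] Thm. 4.4; [Kim2022StructureSelmer] Thm. 1.9 (6), Thm. 3.13; [Kim2025RefinedTNC] Thm 1.1;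
[MazurRubin2004] Thm. 2.3.4, Thm. 5.2.12.
-/

-- the Theorems namespace of a single-conjunct summit repeats the summit name by design (D-0017)
set_option linter.dupNamespace false

noncomputable section

open scoped Classical NumberField
open Function Field NumberField IsDedekindDomain WeierstrassCurve
  Literature.NumberTheory.EllipticCurves Literature.NumberTheory.EllipticCurves.ModularForms
  Literature.NumberTheory.EllipticCurves.Rank1Residual
  Literature.NumberTheory.GaloisRepresentations Literature.NumberTheory.GaloisCohomology
  Summit.BirchSwinnertonDyer.Rank1Residual.GaloisImage Summit.BirchSwinnertonDyer.Rank1Residual.X4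
  Summit.BirchSwinnertonDyer.BirchSwinnertonDyer.Theorems.KimAtThreeKolyvaginDeepLowerKatoStratumPartial

namespace Summit.BirchSwinnertonDyer.BirchSwinnertonDyer.Theorems.KimAtThreeDeepLowerKatoStratumOfFacts

/-- **Poitou–Tate families at every `3`-power level from the named fact**, with the injectivity of
the finite local invariant maps read off `IsPerfect`. [cite: MilneADT2006, Ch. I, Cor. 2.3 and Thm. 4.10(b)]
[cite: Howard2004HeegnerKolyvagin, Thm. 2.1.11 (arXiv:1202.6340 p. 6)] -/
theorem exists_localInvariants_three_pow_of_poitouTate (hPT : poitouTate_selmerStructure_duality ℚ) :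
    ∃ inv' : ∀ k' : ℕ, LocalInvariants ℚ (3 ^ (k' + 1)),
      (∀ k', (inv' k').IsPerfect) ∧ (∀ k', (inv' k').SumLocalTermEqZero) ∧
      (∀ k', (inv' k').SelmerComplement) ∧
      ∀ k', ∀ v : HeightOneSpectrum (𝓞 ℚ), Injective (inv' k' (Sum.inr v)) := by
  have h : ∀ k' : ℕ, ∃ inv' : LocalInvariants ℚ (3 ^ (k' + 1)),
      inv'.IsPerfect ∧ inv'.SumLocalTermEqZero ∧ inv'.UnramifiedOrthogonal ∧ inv'.SelmerComplement :=
    fun k' =>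
      haveI : NeZero (3 ^ (k' + 1)) := ⟨pow_ne_zero _ three_ne_zero⟩
      hPT (3 ^ (k' + 1))
  choose inv' hperf' hsum' _hUO' hcompl' using h
  exact ⟨inv', hperf', hsum', hcompl', fun k' v => ((hperf' k') v).1.injective⟩

/-- **Crux `DeepLowerAtThree` on the Kato stratum at `t = 0`, GRANTED three named published facts and
ONE port** (period-transfer form): kim3's `deepLower_datum_of_ports` with its nine Poitou–Tate binders
supplied by `poitouTate_selmerStructure_duality ℚ` (`hPT 3` for the level-`3` family, `hPT (3^{k′+1})`
for the deep families). For a row {`3`-adic tower onto, additive `3`, `3 ∤ c₃`, `E(ℚ₃)[3] = 0`}, a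
datum `D` at the conductor with `3 ∤ c_D` and the period transfer, primitive roots `η`, the port at
`(v₃, η, D)` and `ord(δ̃) = 0`: `∂^{(∞)}_deep(δ̃) = d ∈ ℕ` and `∂⁽⁰⁾(δ̃) ≤ ord₃ #Ш(E/ℚ)(3) + d`. The
crux stays open; nothing asserted. [cite: Kim2025RefinedTNC, Thm 1.1] [cite: Sakamoto2024, Thm. 4.4 (p. 926)]
[cite: MilneADT2006, Ch. I, Thm. 4.10] [cite: Kim2022StructureSelmer, Thm. 1.9 (6), Thm. 3.13] -/
theorem deepLower_datum_of_ports_of_poitouTate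
    (hS24 : Sakamoto2024.kolyvaginSystems_freeRankOne_zmod_three_pow)
    (hS24₂ : Sakamoto2024.kolyvaginSystems_idealOfBasis_eq_fittingIdeal_zmod_three_pow)
    (hGZK : rank_eq_analyticRank_of_analyticRank_le_one)
    (hPT : poitouTate_selmerStructure_duality ℚ)
    (W : WeierstrassCurve ℚ) [W.IsElliptic] [W.IsGloballyMinimal]
    (hadd : haveI : Fact (Nat.Prime 3) := ⟨Nat.prime_three⟩; Addv W 3)
    (hc3 : ¬ 3 ∣ (W.baseChange ℚ_[3]).localTamagawaNumber ℤ_[3])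
    (htower : ∀ m : ℕ, W.HasSurjectiveModNGaloisRep (3 ^ m : ℕ))
    (ht0 : Nat.card {Q : (W.baseChange ℚ_[3]).toAffine.Point // (3 : ℕ) • Q = 0} = 1)
    {N : ℕ} [NeZero N] (hN : N = W.conductorNorm ℤ) (D : ModularParametrizationData W N)
    (hcD : ¬ (3 : ℤ) ∣ D.maninConstant)
    (hper : ∃ u : ℚ, ‖(u : ℚ_[3])‖ = 1 ∧ W.realPeriodRat = u * plusPeriod D.f)
    (v₃ : HeightOneSpectrum (𝓞 ℚ)) (hv₃ : ((3 : ℕ) : 𝓞 ℚ) ∈ v₃.asIdeal)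
    (η : (q : HeightOneSpectrum (𝓞 ℚ)) → (ZMod (Ideal.absNorm q.asIdeal))ˣ)
    (hη : ∀ q : HeightOneSpectrum (𝓞 ℚ), Subgroup.zpowers (η q) = ⊤)
    (hPort : KatoKuriharaPortThreeAtWith₂ W 0 v₃ η D)
    (hord : kuriharaVanishingOrder W 3 D.f = 0) :
    ∃ d : ℕ, kuriharaPartialDeepInfty W 3 D.f = d ∧
      kuriharaPartial W 3 D.f 0 ≤
        ((padicValNat 3 (Nat.card (AddCommGroup.primaryComponent W.sha 3)) + d : ℕ) : ℕ∞) := by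
  haveI : Fact (Nat.Prime 3) := ⟨Nat.prime_three⟩
  obtain ⟨inv, hperf, hsum, -, hcompl⟩ := hPT 3
  obtain ⟨inv', hperf', hsum', hcompl', hinj'⟩ := exists_localInvariants_three_pow_of_poitouTate hPT
  exact deepLower_datum_of_ports hS24 hS24₂ hGZK W hadd hc3 htower ht0 hN D hcD hper inv hperf hsum hcompl
    inv' hperf' hsum' hcompl' hinj' v₃ hv₃ η hη hPort hord

/-- **The same for an OPTIMAL datum** (`Ω(W) = |c_D|·Ω⁺_{D.f}`, period transfer discharged by
`X4.periodTransfer_of_optimal`): kim3's `deepLower_optimal_of_ports` over `hPT`.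
[cite: Kim2025RefinedTNC, Thm 1.1] [cite: CremonaAlgorithms1997, §2.8 (p. 26)] [cite: MilneADT2006, Ch. I, Thm. 4.10] -/
theorem deepLower_optimal_of_ports_of_poitouTate
    (hS24 : Sakamoto2024.kolyvaginSystems_freeRankOne_zmod_three_pow)
    (hS24₂ : Sakamoto2024.kolyvaginSystems_idealOfBasis_eq_fittingIdeal_zmod_three_pow)
    (hGZK : rank_eq_analyticRank_of_analyticRank_le_one)
    (hPT : poitouTate_selmerStructure_duality ℚ)
    (W : WeierstrassCurve ℚ) [W.IsElliptic] [W.IsGloballyMinimal]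
    (hadd : haveI : Fact (Nat.Prime 3) := ⟨Nat.prime_three⟩; Addv W 3)
    (hc3 : ¬ 3 ∣ (W.baseChange ℚ_[3]).localTamagawaNumber ℤ_[3])
    (htower : ∀ m : ℕ, W.HasSurjectiveModNGaloisRep (3 ^ m : ℕ))
    (ht0 : Nat.card {Q : (W.baseChange ℚ_[3]).toAffine.Point // (3 : ℕ) • Q = 0} = 1)
    {N : ℕ} [NeZero N] (hN : N = W.conductorNorm ℤ) (D : ModularParametrizationData W N)
    (hopt : ∀ z ∈ D.L.lattice, ∃ w ∈ periodLattice D.f, z = D.c * w)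
    (hcD : ¬ (3 : ℤ) ∣ D.maninConstant)
    (v₃ : HeightOneSpectrum (𝓞 ℚ)) (hv₃ : ((3 : ℕ) : 𝓞 ℚ) ∈ v₃.asIdeal)
    (η : (q : HeightOneSpectrum (𝓞 ℚ)) → (ZMod (Ideal.absNorm q.asIdeal))ˣ)
    (hη : ∀ q : HeightOneSpectrum (𝓞 ℚ), Subgroup.zpowers (η q) = ⊤)
    (hPort : KatoKuriharaPortThreeAtWith₂ W 0 v₃ η D)
    (hord : kuriharaVanishingOrder W 3 D.f = 0) :
    ∃ d : ℕ, kuriharaPartialDeepInfty W 3 D.f = d ∧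
      kuriharaPartial W 3 D.f 0 ≤
        ((padicValNat 3 (Nat.card (AddCommGroup.primaryComponent W.sha 3)) + d : ℕ) : ℕ∞) :=
  haveI : Fact (Nat.Prime 3) := ⟨Nat.prime_three⟩
  deepLower_datum_of_ports_of_poitouTate hS24 hS24₂ hGZK hPT W hadd hc3 htower ht0 hN D hcD
    (periodTransfer_of_optimal 3 D hopt hcD) v₃ hv₃ η hη hPort hord

end Summit.BirchSwinnertonDyer.BirchSwinnertonDyer.Theorems.KimAtThreeDeepLowerKatoStratumOfFacts

end
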